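import Mathlib
import Literature.Geometry.Symplectic.GromovR4RelEndProofs
import HarnessLib

/-!
# Darboux coordinates after base change: `A ⊗_K V ≅ Aⁿ × Aⁿ` with `φ_A = x · y' - x' · y`

Topic `LinearAlgebra/Alternating`; namespace `Literature.LinearAlgebra.Alternating`.  KERNEL ONLY: theorems;
no definition, no named fact, no `sorry`.

For a non-degenerate alternating form `φ` on a finite-dimensional vector space `V` over a field `K` and ANY
commutative `K`-algebra `A` (e.g. the adele ring `𝐀_K`, or `K_∞`, `𝐀_K^∞`), the base-changed module
`W_A = A ⊗_K V` admits `A`-linear Darboux coordinates: an `A`-linear isomorphism `e : Aⁿ × Aⁿ ≃ W_A` in which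
the base-changed form `φ_A = φ ⊗ A` (Mathlib `LinearMap.BilinForm.baseChange`) is the standard symplectic
form `φ_A(e(x, y), e(x', y')) = x · y' - x' · y` (**`exists_baseChange_darboux`**).  Proof: a Darboux basis `b`
of `(V, φ)` (Lang, *Algebra*, XV §8 Thm. 8.1; tree `Geometry.Symplectic.exists_symplecticBasis`) base-changes to
the `A`-basis `1 ⊗ b` of `W_A` (Mathlib `Algebra.TensorProduct.basis`) with the same Gram matrix
(`LinearMap.BilinForm.baseChange_tmul`).  Also recorded: the coordinates of a rational vector
(**`exists_baseChange_darboux_rational`**: `e⁻¹(1 ⊗ v)` has entries in `K`).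

This is the linear algebra behind "`(W, φ)` … the associated symplectic space over `F`", `W_𝐀 = W ⊗ 𝐀`
of [GelbartRogawski1991, §3.1 p. 454 L17–22, L40–42] when the adelic Heisenberg group `H_𝐀(W)` is split into
its archimedean and finite-adelic parts in coordinates.

## References
* S. Lang, *Algebra*, rev. 3rd ed., GTM 211 (2002), Ch. XV §8, Theorem 8.1 (alternating forms have a symplectic
  basis). [Lang2002]
* S. Gelbart, J. Rogawski, Invent. Math. 105 (1991), §3.1 p. 454. [GelbartRogawski1991]
-/

set_option autoImplicit false

noncomputable section

open Module
open scoped TensorProduct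

namespace Literature.LinearAlgebra.Alternating

variable {K : Type*} [Field K] {V : Type*} [AddCommGroup V] [Module K V] [FiniteDimensional K V]

omit [FiniteDimensional K V] in
/-- the Gram matrix of the base-changed basis `1 ⊗ b` is the image of the Gram matrix of `b`.
[cite: Lang2002, Ch. XV §8 Thm. 8.1] -/
theorem baseChange_basis_basis (B : LinearMap.BilinForm K V) (A : Type*) [CommRing A] [Algebra K A]
    {ι : Type*} (b : Basis ι K V) (k l : ι) :
    B.baseChange A (Algebra.TensorProduct.basis A b k) (Algebra.TensorProduct.basis A b l) =
      algebraMap K A (B (b k) (b l)) := by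
  rw [Algebra.TensorProduct.basis_apply, Algebra.TensorProduct.basis_apply, LinearMap.BilinForm.baseChange_tmul,
    mul_one, Algebra.algebraMap_eq_smul_one]

omit [FiniteDimensional K V] in
/-- the base-changed form in the coordinates of the base-changed basis: a double sum against the rational Gram
matrix. [cite: Lang2002, Ch. XV §8 Thm. 8.1] -/
theorem baseChange_equivFun_symm (B : LinearMap.BilinForm K V) (A : Type*) [CommRing A] [Algebra K A]
    {ι : Type*} [Fintype ι] (b : Basis ι K V) (c c' : ι → A) :
    B.baseChange A ((Algebra.TensorProduct.basis A b).equivFun.symm c)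
        ((Algebra.TensorProduct.basis A b).equivFun.symm c') =
      ∑ k, ∑ l, c k * c' l * algebraMap K A (B (b k) (b l)) := by
  simp only [Basis.equivFun_symm_apply, map_sum, map_smul, LinearMap.sum_apply, LinearMap.smul_apply,
    smul_eq_mul, baseChange_basis_basis, Finset.mul_sum]
  exact Finset.sum_comm.trans (Finset.sum_congr rfl fun k _ => Finset.sum_congr rfl fun l _ => by ring)

/-- **Darboux coordinates after base change.**  For a non-degenerate alternating form `φ` on a
finite-dimensional `K`-vector space `V` and any commutative `K`-algebra `A` there are `n` and an `A`-linear
isomorphism `e : Aⁿ × Aⁿ ≃ A ⊗_K V` with `φ_A(e(x, y), e(x', y')) = x · y' - x' · y`.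
[cite: Lang2002, Ch. XV §8 Thm. 8.1] -/
theorem exists_baseChange_darboux (B : LinearMap.BilinForm K V) (hA : B.IsAlt) (hN : B.Nondegenerate)
    (A : Type*) [CommRing A] [Algebra K A] :
    ∃ (n : ℕ) (e : ((Fin n → A) × (Fin n → A)) ≃ₗ[A] A ⊗[K] V),
      ∀ c c' : (Fin n → A) × (Fin n → A), B.baseChange A (e c) (e c') = c.1 ⬝ᵥ c'.2 - c'.1 ⬝ᵥ c.2 := by
  classical
  obtain ⟨n, b, h11, h22, h12⟩ := Geometry.Symplectic.exists_symplecticBasis B hA hN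
  have h21 : ∀ i j, B (b (Sum.inr i)) (b (Sum.inl j)) = -(if j = i then (1 : K) else 0) := fun i j => by
    rw [← hA.neg_eq, h12]
  refine ⟨n, (LinearEquiv.sumArrowLequivProdArrow (Fin n) (Fin n) A A).symm ≪≫ₗ
    (Algebra.TensorProduct.basis A b).equivFun.symm, fun c c' => ?_⟩
  obtain ⟨x, y⟩ := c
  obtain ⟨x', y'⟩ := c'
  rw [LinearEquiv.trans_apply, LinearEquiv.trans_apply, baseChange_equivFun_symm]
  simp only [Fintype.sum_sum_type, LinearEquiv.sumArrowLequivProdArrow_symm_apply_inl,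
    LinearEquiv.sumArrowLequivProdArrow_symm_apply_inr, h11, h22, h12, h21, map_zero, mul_zero,
    Finset.sum_const_zero, zero_add, add_zero, apply_ite (algebraMap K A), map_one, map_neg, mul_ite, mul_one,
    mul_neg, Finset.sum_ite_eq, Finset.sum_ite_eq', Finset.mem_univ, if_true, Finset.sum_neg_distrib]
  simp only [dotProduct]
  rw [show (∑ i, x' i * y i) = ∑ i, y i * x' i from Finset.sum_congr rfl fun i _ => mul_comm _ _]
  ring

/-- **Darboux coordinates after base change, with the rational structure**: as in
`exists_baseChange_darboux`, and moreover the rational vectors `1 ⊗ v` have coordinates in `K`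
(the coordinates of `v` in the underlying Darboux basis of `V`). [cite: Lang2002, Ch. XV §8 Thm. 8.1] -/
theorem exists_baseChange_darboux_rational (B : LinearMap.BilinForm K V) (hA : B.IsAlt) (hN : B.Nondegenerate)
    (A : Type*) [CommRing A] [Algebra K A] :
    ∃ (n : ℕ) (e : ((Fin n → A) × (Fin n → A)) ≃ₗ[A] A ⊗[K] V) (e₀ : V ≃ₗ[K] (Fin n → K) × (Fin n → K)),
      (∀ c c' : (Fin n → A) × (Fin n → A), B.baseChange A (e c) (e c') = c.1 ⬝ᵥ c'.2 - c'.1 ⬝ᵥ c.2) ∧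
      ∀ v : V, e (fun i => algebraMap K A ((e₀ v).1 i), fun i => algebraMap K A ((e₀ v).2 i)) = 1 ⊗ₜ v := by
  classical
  obtain ⟨n, b, h11, h22, h12⟩ := Geometry.Symplectic.exists_symplecticBasis B hA hN
  have h21 : ∀ i j, B (b (Sum.inr i)) (b (Sum.inl j)) = -(if j = i then (1 : K) else 0) := fun i j => by
    rw [← hA.neg_eq, h12]
  refine ⟨n, (LinearEquiv.sumArrowLequivProdArrow (Fin n) (Fin n) A A).symm ≪≫ₗ
    (Algebra.TensorProduct.basis A b).equivFun.symm,
    b.equivFun ≪≫ₗ LinearEquiv.sumArrowLequivProdArrow (Fin n) (Fin n) K K, fun c c' => ?_, fun v => ?_⟩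
  · obtain ⟨x, y⟩ := c
    obtain ⟨x', y'⟩ := c'
    rw [LinearEquiv.trans_apply, LinearEquiv.trans_apply, baseChange_equivFun_symm]
    simp only [Fintype.sum_sum_type, LinearEquiv.sumArrowLequivProdArrow_symm_apply_inl,
      LinearEquiv.sumArrowLequivProdArrow_symm_apply_inr, h11, h22, h12, h21, map_zero, mul_zero,
      Finset.sum_const_zero, zero_add, add_zero, apply_ite (algebraMap K A), map_one, map_neg, mul_ite, mul_one,
      mul_neg, Finset.sum_ite_eq, Finset.sum_ite_eq', Finset.mem_univ, if_true, Finset.sum_neg_distrib]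
    simp only [dotProduct]
    rw [show (∑ i, x' i * y i) = ∑ i, y i * x' i from Finset.sum_congr rfl fun i _ => mul_comm _ _]
    ring
  · rw [LinearEquiv.trans_apply, Basis.equivFun_symm_apply]
    conv_rhs => rw [← b.sum_equivFun v, TensorProduct.tmul_sum]
    rw [Fintype.sum_sum_type, Fintype.sum_sum_type]
    simp only [LinearEquiv.sumArrowLequivProdArrow_symm_apply_inl, LinearEquiv.sumArrowLequivProdArrow_symm_apply_inr,
      LinearEquiv.trans_apply, LinearEquiv.sumArrowLequivProdArrow_apply_fst,
      LinearEquiv.sumArrowLequivProdArrow_apply_snd, Algebra.TensorProduct.basis_apply, algebraMap_smul,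
      TensorProduct.tmul_smul]

end Literature.LinearAlgebra.Alternating

end
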